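import Literature.MathematicalPhysics.QuantumFieldTheory.Balaban1983to89.B9CoReadingCoordsL2
import Literature.MathematicalPhysics.QuantumFieldTheory.Balaban1983to89.B9RWSums346SecondDiff

/-!
# `Balaban1983to89.B9CoReadingCoordsL2Pair` — the (3.46) co-readings `L2ReadsNbr` (n06-k) of def-Y's bond-sector reading `kernelFamilyB`
# for the three SECOND-ORDER members (K-index 3 = ∇_UO∇\*_U, 4 = ∇_U∇_UO, 5 = O∇\*_U∇\*_U) HOLD on the PAIR-FAMILY coordinate models
# `familyOp` over single-direction coordinate letters — every letter, every `U`, block map carrier-∕1-faithful, radius `r ≥ 2`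

T. Bałaban, *Propagators for lattice gauge theories in a background field*, Commun. Math. Phys. **99** (1985) 389–434
[`Balaban1985BackgroundPropagators`, "B9"], (3.46) p. 398 (*"‖h∇_UG(U)∇\*_Uλ‖, ‖h∇_U∇_UG(U)λ‖, ‖hG(U)∇\*_U∇\*_Uλ‖ ≦ … supp h ⊂ Δ(y), supp λ ⊂ Δ(y′)"*),
(3.39) p. 397 (*"max_{μ,ν}"*: a two-direction quantity is normed over ALL direction pairs); [4] = T. Bałaban, *Propagators and renormalization
transformations for lattice gauge theories. II*, Commun. Math. Phys. **96** (1984) 223–250 [`Balaban1984PropagatorsII`], (2.51)–(2.52) p. 232, (2.54) p. 233.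

statement-level skeleton of published theorems with citation tags; proofs where landed; nothing here is a claim about the
Yang–Mills mass gap

WHY THIS FILE (dag-n06-d g5's division of the coordinate side, pub-ymgap INBOX 2026-08-27 l.18730: «YOU keep the L² engines: the pair-family
co-readings … four ∕ five … and the PairM mixed … ones, as the sequel of your `B9CoReadingCoordsL2` (lines 0–2)»; seat n06-k g9).  The rows-18∕19
faces of the N06 knit (`B9RWSumsDefinitePinsPair.rows131819_definite_geo9Y_pair`, v3.1, and `B9RWSumsDefinitePinsPairM.rows131819_definite_geo9Y_pairM`,
v4) display the (3.46) co-readings of the three second-order members of the kernel family read from the sum in the neighbourhood-sited species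
`B9RWSumsReadsNbr.L2ReadsNbr K n U Rel r Cev (blk ∘ Prod.fst) blk ev (familyOp T)` — ONE model into the product lattice `X × (Q × Q)` packaging the
direction-PAIR family `T (ν, μ)` (`B9RWSums346SecondDiff.familyOp`; this seat's located point (O4′): one-slot composites only carry the diagonal pairs).
At the record's coordinate pins (`blk := blkBK bI`, `ev := evBK`, `G := GcoK b O cfg U`, and SINGLE-DIRECTION letters `Dd μ := coordOpK b (fun _ => ∇_{U,μ})`,
`Dsd μ := coordOpK b (fun _ => ∇\*_{U,μ})` — n06-d's `B9CoReadingCoordsDir.DdK ∕ DsdK`, quoted here UNFOLDED so that no import race arises) THIS FILE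
discharges them:

* §1 cores: `bl2_member_le_familyOp` (the block-L² size of ONE member of a family is ≦ that of the package — `bsq_familyOp`), the three composite
  identities `pair3_eq ∕ pair4_eq ∕ pair5_eq` (each pair member of the pinned family IS `cR39 • coordOpK` of the genuine composite
  `∇_ν O ∇\*_μ ∕ ∇_ν∇_μ O ∕ O ∇\*_ν∇\*_μ`, by `coordOpK_comp`), and the index bookkeeping `vec6_three ∕ four ∕ five`.
* §2 ★★ `l2ReadsNbr_kernelFamilyB_coords_three ∕ four ∕ five` (literal letters) and ★★ `bond_l2ReadsNbr345_of_pins` (the knit's one-liner: letters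
  `blk G Dd Dsd` with their pin equations, radius 2, the three co-readings as a conjunction — the shape of n06-d's `N06CoReadingsOfPins.bond_l2ReadsNbr3_of_pins`).

The proof of `obs` for the pair (ν, μ): the neighbourhood sum of block-L² sizes of the MEMBER (ν, μ) is ≦ that of the package (§1), the member is the
scaled coordinate model of the genuine composite, and the sibling's core `B9CoReadingCoordsL2.l2OfY_le_of_coordModel` bounds `‖hh·(composite (J ⊗ E))‖₂`;
then `sup_E sup_ν sup_μ ≦ c`.

HONEST SCOPE.  Finite-dimensional bookkeeping over def-Y's readings, n06-d's coordinate gadgets and this seat's `familyOp`; nothing of [B9] or [4]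
asserted; the Hölder (`H1ReadsNbr`) and input (`InputReadsFam`) co-readings are NOT treated (they wait on probe letters at the pins); the SITE sector
(`kernelFamilyS`, G′(U)) is the sequel `B9CoReadingCoordsL2S`.  COUNT-NEUTRAL; N06 NOT discharged; one finite 𝕋^{d+1} programme at fixed ε — nothing
continuum, nothing about the mass gap.  Cell `pub-ymgap` (HUMAN RULING D-0062), Track A node N06 [B9], N06-ASSIGNMENT v1 bundle F6 (rows 18–19),
seat `pub-ymgap-dag-n06-k` (gen 9), 2026-08-27.
-/

noncomputable section

namespace Literature.MathematicalPhysics.QuantumFieldTheory.Balaban1983to89.B9CoReadingCoordsL2Pair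

open B6GlobalChartV1 (PV domT blkV1)
open B6Geom246MultiLevelTorus (geomT)
open B6Ineq2142KLevelV1 (β)
open B6KLevelCensusIndexV1 (KIdx)
open B9GeoNormsKLevelV1 (geo9K geo9K_l2Norm_nonneg geo9K_cutSup_nonneg)
open B9Thm34Ext (toB6)
open B9SectDL2Decay (bl2 bsq bsq_nonneg bl2_nonneg)
open B9CoRealizesRelAtLetters (RelB)
open B9RWSumsReadsNbr (nbr L2ReadsNbr)
open B9RWSums346SecondDiff (familyOp bsq_familyOp)
open B9Thm39ReadingCoords (cR39)
open B9CoReadingCoords (evDiagK coordOpK coordOpK_comp cdBₗ cdsBₗ XBK evBK blkBK GcoK off_bound_evBK)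
open B9CoReadingCoordsL2 (l2OfY_le_of_coordModel l2bound_evBK)
open Node00 (FBondY IBondY CfgY BallY liftY l2OfY kernelFamilyB BondOpY BondParY cdB cdsB iSup_ball_le)

variable {d ℓ : ℕ} {hd : 1 ≤ d + 1} {hL : Odd (ℓ + 1) ∧ 1 < ℓ + 1} {b₀ b₁ : ℝ}
variable {𝔸 : Type} [NormedRing 𝔸] [NormedAlgebra ℂ 𝔸] [CompleteSpace 𝔸] [FiniteDimensional ℝ 𝔸]
variable {κ : Type} [Fintype κ] [DecidableEq κ]

/-! ## §1 Cores: one member of a family against the package; the pair composites are scaled coordinate models; index bookkeeping -/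

section Cores

/-- **ONE MEMBER AGAINST THE PACKAGE**: the block-L² size of the member `T p f` over the fibre of `y` (block map `bu`) is at most the block-L² size of the
package `familyOp T f` over the same fibre (block map `bu ∘ fst`) — the package's square-size is the SUM of the members' (`bsq_familyOp`).
[cite: Balaban1985BackgroundPropagators, (3.39) p.397 («max_{μ,ν}») + (3.46) p.398, bookkeeping] -/
theorem bl2_member_le_familyOp {g : B9.Geometry} [Fintype g.Site] {R : ℝ} {H : Prop} {u v P : Type} [Fintype u] [Fintype P]
    (bu : u → g.Site) (T : P → ((v → ℝ) →ₗ[ℝ] (u → ℝ))) (f : v → ℝ) (y : g.Site) (p : P) :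
    bl2 (g := toB6 g R H) bu y (T p f) ≤ bl2 (g := toB6 g R H) (bu ∘ Prod.fst) y (familyOp T f) := by
  unfold bl2
  refine Real.sqrt_le_sqrt ?_
  rw [bsq_familyOp]
  exact Finset.single_le_sum (f := fun q => bsq (g := toB6 g R H) bu y (T q f)) (fun q _ => bsq_nonneg _ _ _) (Finset.mem_univ p)

/-- the weighted neighbourhood-sum form of `bl2_member_le_familyOp` (the shape of the `obs` hypothesis of `L2ReadsNbr`).
[cite: Balaban1985BackgroundPropagators, (3.46) p.398, bookkeeping] -/
theorem sum_bl2_member_mul_le {g : B9.Geometry} [Fintype g.Site] {R : ℝ} {H : Prop} {u v P : Type} [Fintype u] [Fintype P]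
    (bu : u → g.Site) (T : P → ((v → ℝ) →ₗ[ℝ] (u → ℝ))) (f : v → ℝ) (s : Finset g.Site) {S : ℝ} (hS : 0 ≤ S) (p : P) :
    (∑ y'' ∈ s, bl2 (g := toB6 g R H) bu y'' (T p f)) * S ≤ (∑ y'' ∈ s, bl2 (g := toB6 g R H) (bu ∘ Prod.fst) y'' (familyOp T f)) * S :=
  mul_le_mul_of_nonneg_right (Finset.sum_le_sum fun y'' _ => bl2_member_le_familyOp bu T f y'' p) hS

variable (i : KIdx d ℓ hd hL b₀ b₁) (b : Module.Basis κ ℝ 𝔸) (B : B9.Backgrounds) (cfg : B.Cfg → CfgY 𝔸 i) (O : BondOpY 𝔸 i)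

omit [DecidableEq κ] in
/-- the MIXED pair member `Dd ν ∘ (G ∘ Dsd μ)` of the pinned family IS the `cR39`-scaled coordinate model of `∇_{U,ν} ∘ O(U) ∘ ∇\*_{U,μ}`.
[cite: Balaban1985BackgroundPropagators, (3.46) p.398 (∇_UG∇\*_U), (3.42) p.397, bookkeeping] -/
theorem pair3_eq (U₁ : B.Cfg) (ν μ : Fin (d + 1)) :
    coordOpK b (fun _ : Fin (d + 1) => cdBₗ i (cfg U₁) ν) ∘ₗ (GcoK i b B cfg O U₁ ∘ₗ coordOpK b (fun _ : Fin (d + 1) => cdsBₗ i (cfg U₁) μ)) =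
      cR39 b • coordOpK b (fun _ : Fin (d + 1) => cdBₗ i (cfg U₁) ν ∘ₗ ((O (cfg U₁)).restrictScalars ℝ ∘ₗ cdsBₗ i (cfg U₁) μ)) := by
  simp only [GcoK, LinearMap.smul_comp, LinearMap.comp_smul, coordOpK_comp]

omit [DecidableEq κ] in
/-- the pair member `(Dd ν ∘ Dd μ) ∘ G` IS the `cR39`-scaled coordinate model of `∇_{U,ν}∇_{U,μ} ∘ O(U)`.
[cite: Balaban1985BackgroundPropagators, (3.46) p.398 (∇_U∇_UG), (3.42) p.397, bookkeeping] -/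
theorem pair4_eq (U₁ : B.Cfg) (ν μ : Fin (d + 1)) :
    (coordOpK b (fun _ : Fin (d + 1) => cdBₗ i (cfg U₁) ν) ∘ₗ coordOpK b (fun _ : Fin (d + 1) => cdBₗ i (cfg U₁) μ)) ∘ₗ GcoK i b B cfg O U₁ =
      cR39 b • coordOpK b (fun _ : Fin (d + 1) => (cdBₗ i (cfg U₁) ν ∘ₗ cdBₗ i (cfg U₁) μ) ∘ₗ (O (cfg U₁)).restrictScalars ℝ) := by
  simp only [GcoK, LinearMap.comp_smul, coordOpK_comp]

omit [DecidableEq κ] in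
/-- the pair member `G ∘ (Dsd ν ∘ Dsd μ)` IS the `cR39`-scaled coordinate model of `O(U) ∘ ∇\*_{U,ν}∇\*_{U,μ}`.
[cite: Balaban1985BackgroundPropagators, (3.46) p.398 (G∇\*_U∇\*_U), (3.42) p.397, bookkeeping] -/
theorem pair5_eq (U₁ : B.Cfg) (ν μ : Fin (d + 1)) :
    GcoK i b B cfg O U₁ ∘ₗ (coordOpK b (fun _ : Fin (d + 1) => cdsBₗ i (cfg U₁) ν) ∘ₗ coordOpK b (fun _ : Fin (d + 1) => cdsBₗ i (cfg U₁) μ)) =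
      cR39 b • coordOpK b (fun _ : Fin (d + 1) => (O (cfg U₁)).restrictScalars ℝ ∘ₗ (cdsBₗ i (cfg U₁) ν ∘ₗ cdsBₗ i (cfg U₁) μ)) := by
  simp only [GcoK, LinearMap.smul_comp, coordOpK_comp]

omit [Fintype κ] in
/-- on bond arguments the evaluation IS the diagonal evaluation. [cite: Balaban1985BackgroundPropagators, (3.39) p.397, bookkeeping] -/
private theorem evBK_inr (J : FBondY i → ℝ) : evBK (κ := κ) i (Sum.inr J) = evDiagK J := rfl

/-- entry 3 of a 6-vector. [folklore] -/
private theorem vec6_three {α : Type} (a0 a1 a2 a3 a4 a5 : α) : (![a0, a1, a2, a3, a4, a5] : Fin 6 → α) 3 = a3 := rfl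

/-- entry 4 of a 6-vector. [folklore] -/
private theorem vec6_four {α : Type} (a0 a1 a2 a3 a4 a5 : α) : (![a0, a1, a2, a3, a4, a5] : Fin 6 → α) 4 = a4 := rfl

/-- entry 5 of a 6-vector. [folklore] -/
private theorem vec6_five {α : Type} (a0 a1 a2 a3 a4 a5 : α) : (![a0, a1, a2, a3, a4, a5] : Fin 6 → α) 5 = a5 := rfl

end Cores

/-! ## §2 ★★ The (3.46) co-readings of `kernelFamilyB` on the pair-family coordinate models, entries 3, 4, 5 -/

section L2

variable (i : KIdx d ℓ hd hL b₀ b₁) (b : Module.Basis κ ℝ 𝔸) (B : B9.Backgrounds) (cfg : B.Cfg → CfgY 𝔸 i) (O : BondOpY 𝔸 i)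
  (par : BondParY 𝔸 i) (U₁ : B.Cfg) {R : ℝ} {H : Prop}
variable {bI : FBondY i → IBondY i}

/-- ★★ **ENTRY 3 (MIXED) — `L2ReadsNbr (kernelFamilyB …) 3 U₁ (RelB i) r √((d+1)|κ|) (blkBK bI ∘ fst) (blkBK bI) evBK (familyOp fun p => Dd p.1 ∘ₗ (G ∘ₗ Dsd p.2))`**
at the single-direction coordinate letters, for EVERY bond-sector letter `O`, EVERY `U₁`, every real basis `b`, every radius `r ≥ 2`, given `bI`
carrier-faithful on carrier blocks (`hβI`) and 1-faithful (`hβ1`): the member ‖h∇_{U,ν}O∇\*_{U,μ}(J ⊗ E)‖₂ is read, pair by pair, from the package.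
[cite: Balaban1985BackgroundPropagators, (3.46) p.398 (∇_UG∇\*_U member) + (3.39) p.397; Balaban1984PropagatorsII, (2.51)–(2.52) p.232 + (2.54) p.233] -/
theorem l2ReadsNbr_kernelFamilyB_coords_three [Fintype (geo9K i).Site] [DecidableRel (RelB i)]
    (hβI : ∀ (x : FBondY i) (c : IBondY i), blkV1 i.hN i.D x = β i.hN i.D i.hk c → β i.hN i.D i.hk (bI x) = blkV1 i.hN i.D x)
    (hβ1 : ∀ x : FBondY i, (geomT i.D).dist (β i.hN i.D i.hk (bI x)) (blkV1 i.hN i.D x) ≤ 1) {r : ℝ} (hr : 2 ≤ r) :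
    L2ReadsNbr (R := R) (H := H) (kernelFamilyB i B cfg O par) 3 U₁ (RelB i) r (Real.sqrt ((d + 1) * Fintype.card κ))
      (blkBK i bI ∘ Prod.fst) (blkBK i bI) (evBK i)
      (familyOp fun p : Fin (d + 1) × Fin (d + 1) =>
        coordOpK b (fun _ : Fin (d + 1) => cdBₗ i (cfg U₁) p.1) ∘ₗ
          (GcoK i b B cfg O U₁ ∘ₗ coordOpK b (fun _ : Fin (d + 1) => cdsBₗ i (cfg U₁) p.2))) := by
  refine ⟨(off_bound_evBK (κ := κ) i hβI).1, fun lam y' y'' _ _ => l2bound_evBK i bI lam y'',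
    fun lam => geo9K_l2Norm_nonneg i lam, fun h => geo9K_cutSup_nonneg i h, ?_⟩
  intro lam h y c hc hcut hx
  cases lam with
  | inl f => cases h with
    | inl z => exact hc
    | inr hh => exact hc
  | inr J => cases h with
    | inl z => exact hc
    | inr hh =>
        show (⨆ E : BallY 𝔸, ((![l2OfY hh (O (cfg U₁) (liftY J (E : 𝔸))),
            ⨆ ν : Fin (d + 1), l2OfY hh (cdB i (cfg U₁) ν (O (cfg U₁) (liftY J (E : 𝔸)))),
            ⨆ ν : Fin (d + 1), l2OfY hh (O (cfg U₁) (cdsB i (cfg U₁) ν (liftY J (E : 𝔸)))),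
            ⨆ ν : Fin (d + 1), ⨆ μ : Fin (d + 1), l2OfY hh (cdB i (cfg U₁) ν (O (cfg U₁) (cdsB i (cfg U₁) μ (liftY J (E : 𝔸))))),
            ⨆ ν : Fin (d + 1), ⨆ μ : Fin (d + 1), l2OfY hh (cdB i (cfg U₁) ν (cdB i (cfg U₁) μ (O (cfg U₁) (liftY J (E : 𝔸))))),
            ⨆ ν : Fin (d + 1), ⨆ μ : Fin (d + 1),
              l2OfY hh (O (cfg U₁) (cdsB i (cfg U₁) ν (cdsB i (cfg U₁) μ (liftY J (E : 𝔸)))))] : Fin 6 → ℝ) 3)) ≤ c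
        simp only [vec6_three]
        refine iSup_ball_le (fun E => Real.iSup_le (fun ν => Real.iSup_le (fun μ => ?_) hc) hc) hc
        have hx' := le_trans (sum_bl2_member_mul_le (g := geo9K i) (R := R) (H := H) (blkBK (κ := κ) i bI) _
          (evBK i (Sum.inr J)) (nbr (geo9K i) r y) (geo9K_cutSup_nonneg i (Sum.inr hh)) (ν, μ)) hx
        dsimp only at hx'
        rw [pair3_eq, evBK_inr] at hx'
        exact l2OfY_le_of_coordModel i b hβ1 hr
          (fun _ : Fin (d + 1) => cdBₗ i (cfg U₁) ν ∘ₗ ((O (cfg U₁)).restrictScalars ℝ ∘ₗ cdsBₗ i (cfg U₁) μ)) J hh y hcut hx' E 0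

/-- ★★ **ENTRY 4 — `L2ReadsNbr (kernelFamilyB …) 4 U₁ (RelB i) r √((d+1)|κ|) (blkBK bI ∘ fst) (blkBK bI) evBK (familyOp fun p => (Dd p.1 ∘ₗ Dd p.2) ∘ₗ G)`**:
the member ‖h∇_{U,ν}∇_{U,μ}O(J ⊗ E)‖₂, pair by pair, from the package. [cite: Balaban1985BackgroundPropagators, (3.46) p.398 (∇_U∇_UG member) + (3.39) p.397; Balaban1984PropagatorsII, (2.51)–(2.52) p.232 + (2.54) p.233] -/
theorem l2ReadsNbr_kernelFamilyB_coords_four [Fintype (geo9K i).Site] [DecidableRel (RelB i)]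
    (hβI : ∀ (x : FBondY i) (c : IBondY i), blkV1 i.hN i.D x = β i.hN i.D i.hk c → β i.hN i.D i.hk (bI x) = blkV1 i.hN i.D x)
    (hβ1 : ∀ x : FBondY i, (geomT i.D).dist (β i.hN i.D i.hk (bI x)) (blkV1 i.hN i.D x) ≤ 1) {r : ℝ} (hr : 2 ≤ r) :
    L2ReadsNbr (R := R) (H := H) (kernelFamilyB i B cfg O par) 4 U₁ (RelB i) r (Real.sqrt ((d + 1) * Fintype.card κ))
      (blkBK i bI ∘ Prod.fst) (blkBK i bI) (evBK i)
      (familyOp fun p : Fin (d + 1) × Fin (d + 1) =>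
        (coordOpK b (fun _ : Fin (d + 1) => cdBₗ i (cfg U₁) p.1) ∘ₗ coordOpK b (fun _ : Fin (d + 1) => cdBₗ i (cfg U₁) p.2)) ∘ₗ
          GcoK i b B cfg O U₁) := by
  refine ⟨(off_bound_evBK (κ := κ) i hβI).1, fun lam y' y'' _ _ => l2bound_evBK i bI lam y'',
    fun lam => geo9K_l2Norm_nonneg i lam, fun h => geo9K_cutSup_nonneg i h, ?_⟩
  intro lam h y c hc hcut hx
  cases lam with
  | inl f => cases h with
    | inl z => exact hc
    | inr hh => exact hc
  | inr J => cases h with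
    | inl z => exact hc
    | inr hh =>
        show (⨆ E : BallY 𝔸, ((![l2OfY hh (O (cfg U₁) (liftY J (E : 𝔸))),
            ⨆ ν : Fin (d + 1), l2OfY hh (cdB i (cfg U₁) ν (O (cfg U₁) (liftY J (E : 𝔸)))),
            ⨆ ν : Fin (d + 1), l2OfY hh (O (cfg U₁) (cdsB i (cfg U₁) ν (liftY J (E : 𝔸)))),
            ⨆ ν : Fin (d + 1), ⨆ μ : Fin (d + 1), l2OfY hh (cdB i (cfg U₁) ν (O (cfg U₁) (cdsB i (cfg U₁) μ (liftY J (E : 𝔸))))),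
            ⨆ ν : Fin (d + 1), ⨆ μ : Fin (d + 1), l2OfY hh (cdB i (cfg U₁) ν (cdB i (cfg U₁) μ (O (cfg U₁) (liftY J (E : 𝔸))))),
            ⨆ ν : Fin (d + 1), ⨆ μ : Fin (d + 1),
              l2OfY hh (O (cfg U₁) (cdsB i (cfg U₁) ν (cdsB i (cfg U₁) μ (liftY J (E : 𝔸)))))] : Fin 6 → ℝ) 4)) ≤ c
        simp only [vec6_four]
        refine iSup_ball_le (fun E => Real.iSup_le (fun ν => Real.iSup_le (fun μ => ?_) hc) hc) hc
        have hx' := le_trans (sum_bl2_member_mul_le (g := geo9K i) (R := R) (H := H) (blkBK (κ := κ) i bI) _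
          (evBK i (Sum.inr J)) (nbr (geo9K i) r y) (geo9K_cutSup_nonneg i (Sum.inr hh)) (ν, μ)) hx
        dsimp only at hx'
        rw [pair4_eq, evBK_inr] at hx'
        exact l2OfY_le_of_coordModel i b hβ1 hr
          (fun _ : Fin (d + 1) => (cdBₗ i (cfg U₁) ν ∘ₗ cdBₗ i (cfg U₁) μ) ∘ₗ (O (cfg U₁)).restrictScalars ℝ) J hh y hcut hx' E 0

/-- ★★ **ENTRY 5 — `L2ReadsNbr (kernelFamilyB …) 5 U₁ (RelB i) r √((d+1)|κ|) (blkBK bI ∘ fst) (blkBK bI) evBK (familyOp fun p => G ∘ₗ (Dsd p.1 ∘ₗ Dsd p.2))`**: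
the member ‖hO∇\*_{U,ν}∇\*_{U,μ}(J ⊗ E)‖₂, pair by pair, from the package. [cite: Balaban1985BackgroundPropagators, (3.46) p.398 (G∇\*_U∇\*_U member) + (3.39) p.397; Balaban1984PropagatorsII, (2.51)–(2.52) p.232 + (2.54) p.233] -/
theorem l2ReadsNbr_kernelFamilyB_coords_five [Fintype (geo9K i).Site] [DecidableRel (RelB i)]
    (hβI : ∀ (x : FBondY i) (c : IBondY i), blkV1 i.hN i.D x = β i.hN i.D i.hk c → β i.hN i.D i.hk (bI x) = blkV1 i.hN i.D x)
    (hβ1 : ∀ x : FBondY i, (geomT i.D).dist (β i.hN i.D i.hk (bI x)) (blkV1 i.hN i.D x) ≤ 1) {r : ℝ} (hr : 2 ≤ r) :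
    L2ReadsNbr (R := R) (H := H) (kernelFamilyB i B cfg O par) 5 U₁ (RelB i) r (Real.sqrt ((d + 1) * Fintype.card κ))
      (blkBK i bI ∘ Prod.fst) (blkBK i bI) (evBK i)
      (familyOp fun p : Fin (d + 1) × Fin (d + 1) =>
        GcoK i b B cfg O U₁ ∘ₗ
          (coordOpK b (fun _ : Fin (d + 1) => cdsBₗ i (cfg U₁) p.1) ∘ₗ coordOpK b (fun _ : Fin (d + 1) => cdsBₗ i (cfg U₁) p.2))) := by
  refine ⟨(off_bound_evBK (κ := κ) i hβI).1, fun lam y' y'' _ _ => l2bound_evBK i bI lam y'',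
    fun lam => geo9K_l2Norm_nonneg i lam, fun h => geo9K_cutSup_nonneg i h, ?_⟩
  intro lam h y c hc hcut hx
  cases lam with
  | inl f => cases h with
    | inl z => exact hc
    | inr hh => exact hc
  | inr J => cases h with
    | inl z => exact hc
    | inr hh =>
        show (⨆ E : BallY 𝔸, ((![l2OfY hh (O (cfg U₁) (liftY J (E : 𝔸))),
            ⨆ ν : Fin (d + 1), l2OfY hh (cdB i (cfg U₁) ν (O (cfg U₁) (liftY J (E : 𝔸)))),
            ⨆ ν : Fin (d + 1), l2OfY hh (O (cfg U₁) (cdsB i (cfg U₁) ν (liftY J (E : 𝔸)))),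
            ⨆ ν : Fin (d + 1), ⨆ μ : Fin (d + 1), l2OfY hh (cdB i (cfg U₁) ν (O (cfg U₁) (cdsB i (cfg U₁) μ (liftY J (E : 𝔸))))),
            ⨆ ν : Fin (d + 1), ⨆ μ : Fin (d + 1), l2OfY hh (cdB i (cfg U₁) ν (cdB i (cfg U₁) μ (O (cfg U₁) (liftY J (E : 𝔸))))),
            ⨆ ν : Fin (d + 1), ⨆ μ : Fin (d + 1),
              l2OfY hh (O (cfg U₁) (cdsB i (cfg U₁) ν (cdsB i (cfg U₁) μ (liftY J (E : 𝔸)))))] : Fin 6 → ℝ) 5)) ≤ c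
        simp only [vec6_five]
        refine iSup_ball_le (fun E => Real.iSup_le (fun ν => Real.iSup_le (fun μ => ?_) hc) hc) hc
        have hx' := le_trans (sum_bl2_member_mul_le (g := geo9K i) (R := R) (H := H) (blkBK (κ := κ) i bI) _
          (evBK i (Sum.inr J)) (nbr (geo9K i) r y) (geo9K_cutSup_nonneg i (Sum.inr hh)) (ν, μ)) hx
        dsimp only at hx'
        rw [pair5_eq, evBK_inr] at hx'
        exact l2OfY_le_of_coordModel i b hβ1 hr
          (fun _ : Fin (d + 1) => (O (cfg U₁)).restrictScalars ℝ ∘ₗ (cdsBₗ i (cfg U₁) ν ∘ₗ cdsBₗ i (cfg U₁) μ)) J hh y hcut hx' E 0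

/-- ★★ **THE KNIT'S ONE-LINER — the three second-order (3.46) lines of the bond sector UNDER THE PINS**: for walk letters with `blk = blkBK bI`, `G = GcoK b O cfg U₁`
and single-direction letters `Dd μ = coordOpK b (fun _ => ∇_{U,μ})`, `Dsd μ = coordOpK b (fun _ => ∇\*_{U,μ})` (n06-d's `DdK ∕ DsdK`), the co-readings
`L2ReadsNbr … n U₁ (RelB i) 2 √((d+1)|κ|) (blk ∘ fst) blk evBK (familyOp …)` of the MIXED family (n = 3), the ∇∇ family (n = 4) and the ∇\*∇\* family (n = 5) HOLD.
[cite: Balaban1985BackgroundPropagators, (3.46) p.398, (3.39) p.397; Balaban1984PropagatorsII, (2.51)–(2.54) pp.232–233] -/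
theorem bond_l2ReadsNbr345_of_pins [Fintype (geo9K i).Site] [DecidableRel (RelB i)]
    (hβI : ∀ (x : FBondY i) (c : IBondY i), blkV1 i.hN i.D x = β i.hN i.D i.hk c → β i.hN i.D i.hk (bI x) = blkV1 i.hN i.D x)
    (hβ1 : ∀ x : FBondY i, (geomT i.D).dist (β i.hN i.D i.hk (bI x)) (blkV1 i.hN i.D x) ≤ 1)
    {blk : XBK κ i → IBondY i} {G : (XBK κ i → ℝ) →ₗ[ℝ] (XBK κ i → ℝ)} {Dd Dsd : Fin (d + 1) → ((XBK κ i → ℝ) →ₗ[ℝ] (XBK κ i → ℝ))}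
    (hblk : blk = blkBK i bI) (hG : G = GcoK i b B cfg O U₁)
    (hDd : Dd = fun μ => coordOpK b (fun _ : Fin (d + 1) => cdBₗ i (cfg U₁) μ))
    (hDsd : Dsd = fun μ => coordOpK b (fun _ : Fin (d + 1) => cdsBₗ i (cfg U₁) μ)) :
    L2ReadsNbr (R := R) (H := H) (kernelFamilyB i B cfg O par) 3 U₁ (RelB i) 2 (Real.sqrt ((d + 1) * Fintype.card κ)) (blk ∘ Prod.fst) blk (evBK i)
        (familyOp fun p : Fin (d + 1) × Fin (d + 1) => Dd p.1 ∘ₗ (G ∘ₗ Dsd p.2)) ∧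
      L2ReadsNbr (R := R) (H := H) (kernelFamilyB i B cfg O par) 4 U₁ (RelB i) 2 (Real.sqrt ((d + 1) * Fintype.card κ)) (blk ∘ Prod.fst) blk (evBK i)
        (familyOp fun p : Fin (d + 1) × Fin (d + 1) => (Dd p.1 ∘ₗ Dd p.2) ∘ₗ G) ∧
      L2ReadsNbr (R := R) (H := H) (kernelFamilyB i B cfg O par) 5 U₁ (RelB i) 2 (Real.sqrt ((d + 1) * Fintype.card κ)) (blk ∘ Prod.fst) blk (evBK i)
        (familyOp fun p : Fin (d + 1) × Fin (d + 1) => G ∘ₗ (Dsd p.1 ∘ₗ Dsd p.2)) := by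
  subst hblk hG hDd hDsd
  exact ⟨l2ReadsNbr_kernelFamilyB_coords_three i b B cfg O par U₁ hβI hβ1 le_rfl,
    l2ReadsNbr_kernelFamilyB_coords_four i b B cfg O par U₁ hβI hβ1 le_rfl,
    l2ReadsNbr_kernelFamilyB_coords_five i b B cfg O par U₁ hβI hβ1 le_rfl⟩

end L2

end Literature.MathematicalPhysics.QuantumFieldTheory.Balaban1983to89.B9CoReadingCoordsL2Pair

end
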